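import Literature.MathematicalPhysics.QuantumFieldTheory.Balaban1983to89.B9B8KnitLetterPeriodic

/-!
# `Balaban1983to89.B9B8KnitLetterRegular` — JUNCTION J-B, FILE 4b: on the SMALL-PLAQUETTE class ([B7] (52)) the knit's transporters are `G`-valued,
# so [B9] Thm 3.11's positivity at the knit letter and the consumer's (E1) hold with NO transporter hypothesis left

statement-level skeleton of published theorems with citation tags; proofs where landed; nothing here is a claim about the
Yang–Mills mass gap

T. Bałaban, *Averaging operations for lattice gauge theories*, Commun. Math. Phys. **98** (1985) 17–51 [`Balaban1985Averaging`, "[B7]"]; T. Bałaban,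
*Propagators for lattice gauge theories in a background field*, Commun. Math. Phys. **99** (1985) 389–434 [`Balaban1985BackgroundPropagators`, "[B9]"];
T. Bałaban, *Spaces of regular gauge field configurations on a lattice and gauge fixing conditions*, Commun. Math. Phys. **99** (1985) 75–102
[`Balaban1985RegularSpaces`, "[B8]"].

THE PRINT.  [B7] Prop. 2 p. 26: *«Let us assume that U satisfies |U(∂p) − 1| < α₀η² (52) … then all Ū^j, j ≤ k, are defined and …»* — the averages stay in
the gauge group (tacit in print, `B7Prop2Explicit.avgIter_mem`); [B9] p. 395: *«Assuming some regularity of the configuration U it can be easily shown that the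
operator Δ′_a is positive»*; (3.35) p. 396 (the regularity class; its plaquette consequence (3.69) p. 404).

CITATION HEADER (lean-in-tree rule).  Cell `lit-balaban`, sub-row G-B9-LETTERS, junction J-B (lead RULING #3) file 4b → seat `lit-balaban-p33` gen 91.  REUSED BY
NAME: `B7Prop2Explicit.avgIter_mem ∕ AvgClosed ∕ pdev ∕ hol_plaqWord_self ∕ hol_mem_of`, `B7Prop1Explicit.norm_inv_sub_one_le`, J-A (`liftCfg`, `transl_add_e`),
J-B files 1∕3∕4a (`parOfT`, `knitT`, `parKnitY`, `deltaPrimeAY_parKnitY_posDefTr`, `knit_E1`).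

WHAT THIS FILE PROVES (sorry-free; no definitions).
* §1 THE PLAQUETTE DICTIONARY: the knit's plaquette holonomy of the periodic lift IS def-Y's `holY` (`hol_liftCfg_plaqWord`), the reversed plaquette is the
  inverse (`hol_plaqWord_swap`); hence ★ `pdev (liftCfg U) ≤ θ` whenever every torus plaquette has `‖U(∂p) − 1‖ ≤ θ` (`pdev_liftCfg_le`).
* §2 `G`-VALUED LEGS: composite transporters of `G`-valued legs are `G`-valued (`compT_mem`, `parOfT_mem`); ★★ on [B7]'s class (52) — `pdev (liftCfg U) <
  α₀(L^k)⁻²` with Prop. 2's smallness of `α₀` and an averaging-closed `G` — every value of `parKnitY U` lies in `G` (`parKnitY_mem_of_pdev`, by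
  `avgIter_mem`).
* §3 ★★★ COROLLARIES WITH NO TRANSPORTER HYPOTHESIS: `deltaPrimeAY_parKnitY_posDefTr_of_pdev` ([B9] p. 395 at the knit letter on the (52) class) and
  `knit_E1_of_pdev` (the consumer's (E1) at every point of `ℤ^{d+1}` for periodic arguments).

HONEST SCOPE.  (i) The smallness is [B7]'s (52) ON EVERY PLAQUETTE OF THE TORUS (hypothesis `hplaq`∕`h52`), with Prop. 2's explicit constants `C₀(d+1)α₀ ≤ 1∕3`,
`2α₀ ≤ c₂′(d+1, L)`; the typed (3.35) class `Reg335` yields (3.69) only on covered plaquettes (`B9Eq335CoverageAtLettersY`), so the passage (3.35) ⇒ (52) is NOT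
asserted here.  (ii) `G` averaging-closed (`AvgClosed`; `U(N)`: `avgClosed_unitaryUnits`) and `G ≤ U(N)`.  (iii) Periodic arguments only (RULING asked
2026-08-28T02:2xZ, (R-E1)).  No estimate of [B8]∕[B9] is proved or asserted; count-neutral; nothing continuum, nothing about OS axioms or the mass gap.
No `sorry`, no `axiom`, no `instance`, no `notation`.  Seat `lit-balaban-p33` gen 91, 2026-08-28.
-/

noncomputable section

namespace Literature.MathematicalPhysics.QuantumFieldTheory.Balaban1983to89.B9B8KnitLetterRegular

open B7Prop1Explicit renaming Site → LSite
open B7Prop1Explicit (e hol plaqWord U1 norm_inv_sub_one_le)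
open Literature.MathematicalPhysics.QuantumLattice (blockMap blockBase)
open B7Eq78Linearization (QprimeIter zdBlocking)
open B7Prop2Explicit (avgIter avgIter_mem AvgClosed pdev hol_plaqWord_self hol_mem_of C0 c2')
open B8Eq119TwistedAxial (bgT)
open B8Eq138LandauZd (covLap QT)
open B8Thm4TorusAt (torusLam)
open B10Eq27TorusAxialLog (transl transl_add_e)
open B6GlobalChartV1 (PV boxEquiv)
open B6KLevelCensusIndexV1 (KIdx)
open B9B8CarrierDictionary (liftFun liftCfg liftCfg_apply liftCfg_mem)
open B9B8AveragingKernelZd (compT compT_zero compT_succ)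
open B9B8AveragingJunction (knitT parOfT parKnitY)
open B9B8DeltaPrimeJunction (awOp cKnit)
open B9Thm311ReadingCoords (PosDefTr)
open B9Thm311PositivityKnitLetter (GpKnitY deltaPrimeAY_parKnitY_posDefTr)
open B9B8KnitLetterPeriodic (knit_E1)
open Node00

variable {d ℓ : ℕ} {hd : 1 ≤ d + 1} {hL : Odd (ℓ + 1) ∧ 1 < ℓ + 1} {b₀ b₁ : ℝ}

/-! ## §1 The plaquette dictionary and `pdev` of the periodic lift -/

section Plaquettes

variable {𝔸 : Type} [NormedRing 𝔸] [NormOneClass 𝔸] [NormedAlgebra ℂ 𝔸] [CompleteSpace 𝔸]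
variable (i : KIdx d ℓ hd hL b₀ b₁)

omit [NormOneClass 𝔸] in
/-- ★ the knit's plaquette holonomy of the periodic lift IS def-Y's torus plaquette variable `U(∂p)` at the charted corner.
[cite: Balaban1985Averaging, (5) p.18, (9) p.18; Balaban1985BackgroundPropagators, (3.7) p.391] -/
theorem hol_liftCfg_plaqWord (U : CfgY 𝔸 i) (x : LSite (d + 1)) {κ ν : Fin (d + 1)} (hκν : κ < ν) :
    hol (liftCfg U) x (plaqWord κ ν) = holY i U ⟨transl 0 x, κ, ν, hκν⟩ := by
  rw [B7Prop1Local.hol_plaqWord_eq, liftCfg_apply, liftCfg_apply, liftCfg_apply, liftCfg_apply, transl_add_e, transl_add_e]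
  rfl

omit [NormOneClass 𝔸] [NormedAlgebra ℂ 𝔸] [CompleteSpace 𝔸] in
/-- the reversed plaquette has the inverse holonomy. [cite: Balaban1985Averaging, (9) p.18 («U(−b) = U(b)⁻¹»)] -/
theorem hol_plaqWord_swap (V : LSite (d + 1) → Fin (d + 1) → 𝔸ˣ) (x : LSite (d + 1)) (κ ν : Fin (d + 1)) :
    hol V x (plaqWord ν κ) = (hol V x (plaqWord κ ν))⁻¹ := by
  rw [B7Prop1Local.hol_plaqWord_eq, B7Prop1Local.hol_plaqWord_eq]
  simp only [mul_inv_rev, inv_inv, mul_assoc]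

/-- ★ **`pdev` OF THE PERIODIC LIFT IS BOUNDED BY THE TORUS PLAQUETTE FIELD**: if `‖U(∂p) − 1‖ ≤ θ` for every plaquette of the member's torus (`U` with
values in `{|u| ≤ 1, |u⁻¹| ≤ 1}`), then [B7]'s `pdev (liftCfg U) ≤ θ`. [cite: Balaban1985Averaging, (52) p.26; Balaban1985BackgroundPropagators, (3.69) p.404] -/
theorem pdev_liftCfg_le (U : CfgY 𝔸 i) (hU1 : ∀ μ x, U μ x ∈ U1 𝔸) {θ : ℝ} (hθ : 0 ≤ θ)
    (hplaq : ∀ p : PlaqY i, ‖((holY i U p : 𝔸ˣ) : 𝔸) - 1‖ ≤ θ) : pdev (liftCfg U) ≤ θ := by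
  have hV1 : ∀ (y : LSite (d + 1)) (μ : Fin (d + 1)), liftCfg U y μ ∈ U1 𝔸 := fun y μ => liftCfg_mem hU1 y μ
  unfold pdev
  refine ciSup_le fun p => ?_
  obtain ⟨x, κ, ν⟩ := p
  dsimp only
  rcases lt_trichotomy κ ν with h | h | h
  · rw [hol_liftCfg_plaqWord i U x h]; exact hplaq _
  · subst h; rw [hol_plaqWord_self, Units.val_one, sub_self, norm_zero]; exact hθ
  · rw [hol_plaqWord_swap]
    refine (norm_inv_sub_one_le (hol_mem_of hV1 x _)).trans ?_
    rw [hol_liftCfg_plaqWord i U x h]; exact hplaq _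

end Plaquettes

/-! ## §2 `G`-valued legs -/

section Legs

variable {𝔸 : Type} [NormedRing 𝔸] [NormOneClass 𝔸] [NormedAlgebra ℂ 𝔸] [CompleteSpace 𝔸]
variable (i : KIdx d ℓ hd hL b₀ b₁) {G : Subgroup 𝔸ˣ}

omit [NormOneClass 𝔸] [NormedAlgebra ℂ 𝔸] [CompleteSpace 𝔸] in
/-- composite transporters of `G`-valued legs (levels `< j`) are `G`-valued. [cite: Balaban1985BackgroundPropagators, (3.19) p.393 («U(Γ^{(j)}_{y,x})»), bookkeeping] -/
theorem compT_mem (L : ℕ) {T : ℕ → LSite (d + 1) → LSite (d + 1) → 𝔸ˣ} :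
    ∀ (j : ℕ), (∀ j' < j, ∀ y x, T j' y x ∈ G) → ∀ y x, compT L T j y x ∈ G
  | 0, _, y, x => by rw [compT_zero]; exact G.one_mem
  | j + 1, hT, y, x => by
      rw [compT_succ]
      exact G.mul_mem (hT j (Nat.lt_succ_self j) _ _) (compT_mem L j (fun j' hj' => hT j' (Nat.lt_succ_of_lt hj')) _ _)

omit [NormOneClass 𝔸] [NormedAlgebra ℂ 𝔸] [CompleteSpace 𝔸] in
/-- the knit transporter to a site is `G`-valued when the legs of levels `< k` are. [cite: Balaban1985BackgroundPropagators, (3.19) p.393, bookkeeping] -/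
theorem knitT_mem {T : ℕ → LSite (d + 1) → LSite (d + 1) → 𝔸ˣ} (hT : ∀ j < i.k, ∀ y x, T j y x ∈ G) (w : SiteY i) : knitT i T w ∈ G :=
  compT_mem (ℓ + 1) (levY i w) (fun j' hj' => hT j' (lt_of_lt_of_le hj' ((toKT i).D.lev_le w.1))) _ _

omit [NormOneClass 𝔸] [NormedAlgebra ℂ 𝔸] [CompleteSpace 𝔸] in
/-- every value of the letter `parOfT T` is `G`-valued when the legs of levels `< k` are. [cite: Balaban1985BackgroundPropagators, (3.19) p.393, (3.24) p.394, bookkeeping] -/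
theorem parOfT_mem {T : ℕ → LSite (d + 1) → LSite (d + 1) → 𝔸ˣ} (hT : ∀ j < i.k, ∀ y x, T j y x ∈ G) (z w : SiteY i) : parOfT i T z w ∈ G := by
  unfold parOfT
  split_ifs
  · exact knitT_mem i hT w
  · exact G.inv_mem (knitT_mem i hT z)
  · exact G.one_mem

/-- ★★ **ON [B7]'s CLASS (52) THE KNIT LETTER IS `G`-VALUED**: for an averaging-closed gauge group `G`, a `G`-valued torus background `U` whose periodic lift
has `pdev < α₀(L^k)⁻²` with Prop. 2's smallness of `α₀`, all averages `Ū^j`, `j ≤ k`, are `G`-valued (`avgIter_mem`), hence so are the block legs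
`Ū^j(Γ_{Ly,x})` and every value of `parKnitY U`. [cite: Balaban1985Averaging, (52)–(53) p.26, (42)–(43) pp.23–24; Balaban1985BackgroundPropagators, (3.19) p.393] -/
theorem parKnitY_mem_of_pdev (hG : AvgClosed (d + 1) (ℓ + 1) G) {U : CfgY 𝔸 i} (hU : ∀ μ x, U μ x ∈ G) {α₀ : ℝ} (hα : 0 < α₀)
    (hα3 : C0 (d + 1) * α₀ ≤ 1 / 3) (hα2 : 2 * α₀ ≤ c2' (d + 1) (ℓ + 1))
    (h52 : pdev (liftCfg U) < α₀ * ((((ℓ + 1 : ℕ) : ℝ) ^ i.k)⁻¹) ^ 2) (z w : SiteY i) : parKnitY i U z w ∈ G := by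
  have hL2 : 2 ≤ ℓ + 1 := hL.2
  have hV : ∀ (x : LSite (d + 1)) (κ : Fin (d + 1)), liftCfg U x κ ∈ G := fun x κ => liftCfg_mem hU x κ
  have havg := avgIter_mem (ℓ + 1) hL2 hG i.k (liftCfg U) hV hα hα3 hα2 h52
  exact parOfT_mem i (fun j hj y x => hol_mem_of (havg j hj.le) _ _) z w

end Legs

/-! ## §3 Corollaries with no transporter hypothesis -/

section Corollaries

open scoped Matrix Matrix.Norms.L2Operator

variable {N : ℕ} (i : KIdx d ℓ hd hL b₀ b₁) {G : Subgroup (Matrix (Fin N) (Fin N) ℂ)ˣ}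

/-- ★★★ **[B9] p. 395 AT THE KNIT LETTER ON THE (52) CLASS**: for `G ≤ U(N)` averaging-closed, a `G`-valued torus background with `pdev (liftCfg U) < α₀(L^k)⁻²`
and Prop. 2's smallness of `α₀`, `Δ′_a(U)` at `parKnitY` is positive definite. [cite: Balaban1985BackgroundPropagators, p.395, Thm 3.11 p.416; Balaban1985Averaging, (52) p.26] -/
theorem deltaPrimeAY_parKnitY_posDefTr_of_pdev [Nonempty (Fin N)] (hGU : G ≤ B7Prop2Explicit.unitaryUnits (Matrix (Fin N) (Fin N) ℂ))
    (hG : AvgClosed (d + 1) (ℓ + 1) G) {U : CfgY (Matrix (Fin N) (Fin N) ℂ) i} (hU : ∀ μ x, U μ x ∈ G) {α₀ : ℝ} (hα : 0 < α₀)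
    (hα3 : C0 (d + 1) * α₀ ≤ 1 / 3) (hα2 : 2 * α₀ ≤ c2' (d + 1) (ℓ + 1))
    (h52 : pdev (liftCfg U) < α₀ * ((((ℓ + 1 : ℕ) : ℝ) ^ i.k)⁻¹) ^ 2) :
    PosDefTr (fun _ => (1 : ℝ)) (deltaPrimeAY i (parKnitY i) U) :=
  deltaPrimeAY_parKnitY_posDefTr i hGU hU (parKnitY_mem_of_pdev i hG hU hα hα3 hα2 h52)

/-- ★★★ **THE CONSUMER's (E1) ON THE (52) CLASS, NO TRANSPORTER HYPOTHESIS**: at every `x ∈ ℤ^{d+1}`, for the periodic lift of every box-chart `X`.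
[cite: Balaban1985BackgroundPropagators, (3.24)–(3.25) pp.394–395, Thm 3.11 p.416; Balaban1985RegularSpaces, (1.95) p.91, (1.29) p.81; Balaban1985Averaging, (52) p.26] -/
theorem knit_E1_of_pdev [Nonempty (Fin N)] {n : ℕ} (hlev : ∀ z : SiteY i, levY i z = n) (hGU : G ≤ B7Prop2Explicit.unitaryUnits (Matrix (Fin N) (Fin N) ℂ))
    (hG : AvgClosed (d + 1) (ℓ + 1) G) {U : CfgY (Matrix (Fin N) (Fin N) ℂ) i} (hU : ∀ μ x, U μ x ∈ G) {α₀ : ℝ} (hα : 0 < α₀)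
    (hα3 : C0 (d + 1) * α₀ ≤ 1 / 3) (hα2 : 2 * α₀ ≤ c2' (d + 1) (ℓ + 1))
    (h52 : pdev (liftCfg U) < α₀ * ((((ℓ + 1 : ℕ) : ℝ) ^ i.k)⁻¹) ^ 2) {η : ℝ} (hη : η ≠ 0)
    (X : SiteY i → Matrix (Fin N) (Fin N) ℂ) (x : LSite (d + 1)) :
    covLap η (liftCfg U) (liftFun ((GpKnitY i η U X) ∘ ⇑(boxEquiv i.hN))) x
        + QT (ℓ + 1) n (torusLam n) (liftCfg U)
            (awOp (cKnit (d := d) (ℓ := ℓ) η) fun j =>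
              QprimeIter (zdBlocking (d + 1) (ℓ + 1)) (bgT (ℓ + 1) (liftCfg U)) j (liftFun ((GpKnitY i η U X) ∘ ⇑(boxEquiv i.hN)))) x
      = liftFun (X ∘ ⇑(boxEquiv i.hN)) x :=
  knit_E1 i hlev hGU hU (parKnitY_mem_of_pdev i hG hU hα hα3 hα2 h52) hη X x

/-- the same two corollaries for `G = U(N)` itself (averaging-closed by `B7Prop2Explicit.avgClosed_unitaryUnits`). [cite: Balaban1985Averaging, (42)–(43) pp.23–24, (52) p.26; Balaban1985BackgroundPropagators, p.395] -/
theorem deltaPrimeAY_parKnitY_posDefTr_unitary_of_pdev [Nonempty (Fin N)] {U : CfgY (Matrix (Fin N) (Fin N) ℂ) i}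
    (hU : ∀ μ x, U μ x ∈ B7Prop2Explicit.unitaryUnits (Matrix (Fin N) (Fin N) ℂ)) {α₀ : ℝ} (hα : 0 < α₀)
    (hα3 : C0 (d + 1) * α₀ ≤ 1 / 3) (hα2 : 2 * α₀ ≤ c2' (d + 1) (ℓ + 1))
    (h52 : pdev (liftCfg U) < α₀ * ((((ℓ + 1 : ℕ) : ℝ) ^ i.k)⁻¹) ^ 2) :
    PosDefTr (fun _ => (1 : ℝ)) (deltaPrimeAY i (parKnitY i) U) := by
  letI : CStarAlgebra (Matrix (Fin N) (Fin N) ℂ) := {}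
  exact deltaPrimeAY_parKnitY_posDefTr_of_pdev i le_rfl (B7Prop2Explicit.avgClosed_unitaryUnits (d + 1) (ℓ + 1)) hU hα hα3 hα2 h52

end Corollaries

end Literature.MathematicalPhysics.QuantumFieldTheory.Balaban1983to89.B9B8KnitLetterRegular

end
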